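import Summits.ResolutionOfSingularities.ResolutionOfSingularities.Theorems.FrobeniusLadderFInjectiveMacaulayficationFullBlowupOfLocalDoor
import HarnessLib

/-!
# THE YARDSTICK CERTIFICATE OF DOOR v36 «LocalDoor», IN THE KERNEL: local resolution (Temkin 2008, Prop. 2.3.4 (iii)) ⇒ both registered stubs
# (crux `FInjectiveMacaulayfication` stmt-ResolutionOfSingularities-15315, chain w45a; res-L1-w45a-plan-1 R17.4/R17.6, res-L1-w45a-tri-2's ≤ S_loc
# certificates (rows #319–#323) made theorems; seat res-L1-w45a-stub-2 g6)

[OURS · L1 W4.5a] Support file (`--supports stmt-ResolutionOfSingularities-15315 --as helper`); replaces the role of NO printed item; NOT a statement of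
the manuscript; def-free; AI-written (AI review is weaker than expert review).

THE YARDSTICK. The door registers research stubs only if each is «≤ S»: implied by (local) resolution of singularities. For v36/v36.1 the stubs are the
two LOCAL statements (LR♭) `RegularOffFiniteOfLRFibre.LocalResolutionNonClosedGe4Fibre` (res-L1-w45a-stub-3) and (LF_cl)
`LocalFullificationFibreClosedGe4.LocalFullificationFibreClosedGe4` (this seat), with the stronger filed forms (LR), (LF), (L4♭), (L4). Here S_loc :=
Temkin's condition 2.3.4 (iii) over every field, as typed in the tree: `Literature.AlgebraicGeometry.Resolution.LocalBlowupsAdmitDesingularization (Spec k)`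
(«every blowing up `S′` of `Spec 𝒪_{X,x}`, `X/k` of finite type, with `S′_sing ⊆` closed fibre, admits a desingularization» = a blowing up with centre in
`Sing S′` and regular source, Temkin Def. 2.2.6). THIS FILE PROVES, with no other input:
* `localResolutionNonClosedGe4Fibre_of_localRes : (∀ k, LocalBlowupsAdmitDesingularization (Spec k)) → (LR♭)` — (LR♭) IS Temkin (iii) sliced;
* `localFullificationFibreGe4_of_localRes : (∀ k, …) → (LF)` — a desingularization `S″ → S′` of the fibre-singular `S′` is a blowing up along a
  centre `J` in `Sing S′ ⊆` closed fibre, `J ≠ ⊥` (the generic point of the integral `S′` is regular), and every blowing up along `J` is `≅ S″`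
  (`IsBlowup.unique`), regular, hence FULL (`FTemkinClosedPoints.fullCl_of_isRegularLocalRing`, characteristic `p` from the structure map to `k`);
* hence `(LF_cl)`, `(L4♭)`, and the Sing-supported (L4) `LocalFullificationDimFour` (`…_of_localRes` corollaries), by the same centre;
* **`exists_isBlowup_full_of_localRes (hT) (hG h081R hP) … (hd : 4 ≤ dim X)`** — the FULL blow-up model of every variety of dimension `≥ 4`, modulo
  the threefold package and S_loc only (through this seat's weakest-pair engine `FullBlowupOfLocalDoor.exists_isBlowup_full_of_LFclosed_of_LRfibre`).
So the registered residue of v36/v36.1 is ≤ S_loc STUB BY STUB, as a kernel statement; the converse direction (the crux does NOT need full local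
resolution at the closed points of the top dimension — only FULL-ification) is the route's content (tri-2's «price tag» Q-LdF).
[folklore assembly; cite: Temkin2008, Prop. 2.3.4 (iii) and Def. 2.2.6] [cite: StacksProject, Tag 085U] [cite: Matsumura1987, Thm. 17.4 (regular ⇒ CM)]
[cite: Kunz1969, Thm. 2.1 (regular ⇒ F-injective, context)]
-/

-- single-problem summit: the doubled namespace component is forced
set_option linter.dupNamespace false

noncomputable section

namespace Summit.ResolutionOfSingularities.ResolutionOfSingularities.Theorems.FInjectiveMacaulayfication.LocalDoorYardstick

open CategoryTheory CategoryTheory.Limits AlgebraicGeometry TopologicalSpace IsLocalRing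
open Literature.AlgebraicGeometry.Resolution
open Summit.ResolutionOfSingularities.ResolutionOfSingularities.Theorems.FInjectiveMacaulayfication
open SliceableCentre

/-! ## §1 (LR♭) is Temkin (iii) sliced -/

/-- **S_loc ⇒ (LR♭).** [folklore; cite: Temkin2008, Prop. 2.3.4 (iii)] -/
theorem localResolutionNonClosedGe4Fibre_of_localRes
    (hT : ∀ (k : Type) [Field k], LocalBlowupsAdmitDesingularization (Spec (.of k))) :
    RegularOffFiniteOfLRFibre.LocalResolutionNonClosedGe4Fibre := by
  intro p hp k _ _ X f hsep hft hqc hint x _ _ S' g I hg hfib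
  haveI := hft; haveI := hqc
  exact hT k X f x inferInstance S' g I hg hfib

/-! ## §2 S_loc ⇒ (LF): the desingularization centre is the FULL-ification centre -/

/-- The core: for `S′ → Spec 𝒪_{X,x}` a blowing up along `I ≠ ⊥` that is regular off its closed fibre (`X/k` an integral variety, `char k = p`), a
desingularization of `S′` yields a fibre-supported (indeed `Sing S′`-supported) centre `𝓚 ≠ ⊥` all of whose blowings up are FULL at every point.
[folklore; cite: Temkin2008, Def. 2.2.6] [cite: StacksProject, Tag 085U] -/
theorem exists_fullCentre_of_admitsDesingularization
    (p : ℕ) (hp : p.Prime) {k : Type} [Field k] [CharP k p] {X : Scheme.{0}} (f : X ⟶ Spec (.of k))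
    [LocallyOfFiniteType f] [IsIntegral X] (x : X)
    (S' : Scheme.{0}) (g : S' ⟶ Spec (X.presheaf.stalk x)) (I : (Spec (X.presheaf.stalk x)).IdealSheafData)
    (hI : I ≠ ⊥) (hg : IsBlowup g I)
    (hreg : ∀ s : S', g.base s ≠ closedPoint (X.presheaf.stalk x) → s ∈ Scheme.regularLocus S')
    (hdes : Scheme.AdmitsDesingularization S') :
    ∃ 𝓚 : S'.IdealSheafData, 𝓚 ≠ ⊥ ∧ (𝓚.support : Set S') ⊆ (Scheme.regularLocus S')ᶜ ∧
      (∀ s ∈ (𝓚.support : Set S'), g.base s = closedPoint (X.presheaf.stalk x)) ∧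
      ∀ (S'' : Scheme.{0}) (π : S'' ⟶ S'), IsBlowup π 𝓚 → ∀ s : S'', FullCl p (S''.presheaf.stalk s) := by
  haveI : Fact p.Prime := ⟨hp⟩
  haveI : IsLocallyNoetherian X := LocallyOfFiniteType.isLocallyNoetherian f
  haveI : IsIntegral S' := hg.isIntegral hI
  obtain ⟨S₁, π₁, ⟨⟨J, hπ₁, hJ⟩, hreg₁⟩⟩ := hdes
  -- `J ≠ ⊥`: the generic point of the integral `S'` is regular, hence not in `supp J ⊆ Sing S'`
  have hJne : J ≠ ⊥ := by
    intro h0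
    have hgen : genericPoint S' ∈ (J.support : Set S') := by rw [h0, Scheme.IdealSheafData.support_bot]; trivial
    exact hJ hgen (genericPoint_mem_regularLocus S')
  refine ⟨J, hJne, hJ, fun s hs => ?_, fun S'' π hπ s => ?_⟩
  · by_contra hne
    exact hJ hs (hreg s hne)
  · -- every blowing up along `J` is `≅ S₁` over `S'`; `S₁` is regular, hence FULL (characteristic `p` via the structure map to `k`)
    obtain ⟨e, -, -⟩ := hπ.unique hπ₁
    have hreg' : IsRegularLocalRing (S₁.presheaf.stalk (e.hom s)) := hreg₁ (e.hom s)
    haveI := hreg'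
    haveI : CharP (S₁.presheaf.stalk (e.hom s)) p :=
      FTemkinClosedPoints.charP_stalk_of_over p f (π₁ ≫ g ≫ X.fromSpecStalk x) (e.hom s)
    exact FTemkinClosedPoints.fullCl_of_isIso_stalkMap' p e.hom s (FTemkinClosedPoints.fullCl_of_isRegularLocalRing p _)

/-- **S_loc ⇒ (LF).** [folklore; cite: Temkin2008, Prop. 2.3.4 (iii)] -/
theorem localFullificationFibreGe4_of_localRes
    (hT : ∀ (k : Type) [Field k], LocalBlowupsAdmitDesingularization (Spec (.of k))) :
    LocalFullificationFibreGe4.LocalFullificationFibreGe4 := by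
  intro d _ p hp k _ _ X f hsep hft hqc hint x _ S' g I hI hg hreg
  haveI := hft; haveI := hqc
  have hdes : Scheme.AdmitsDesingularization S' :=
    hT k X f x inferInstance S' g I hg fun s hs => by
      by_contra hne
      exact hs (hreg s hne)
  obtain ⟨𝓚, h1, -, h3, h4⟩ := exists_fullCentre_of_admitsDesingularization p hp f x S' g I hI hg hreg hdes
  exact ⟨𝓚, h1, h3, h4⟩

/-- **S_loc ⇒ (LF_cl)** (the registered stub of v36.1). [folklore] -/
theorem localFullificationFibreClosedGe4_of_localRes
    (hT : ∀ (k : Type) [Field k], LocalBlowupsAdmitDesingularization (Spec (.of k))) :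
    LocalFullificationFibreClosedGe4.LocalFullificationFibreClosedGe4 :=
  LocalFullificationFibreClosedGe4.localFullificationFibreClosedGe4_of_ge4 (localFullificationFibreGe4_of_localRes hT)

/-- **S_loc ⇒ (L4♭)** (the registered stub of v35). [folklore] -/
theorem localFullificationDimFourFibre_of_localRes
    (hT : ∀ (k : Type) [Field k], LocalBlowupsAdmitDesingularization (Spec (.of k))) :
    LocalFullificationDimFourFibre.LocalFullificationDimFourFibre :=
  LocalFullificationFibreGe4.localFullificationDimFourFibre_of_ge4 (localFullificationFibreGe4_of_localRes hT)

/-- **S_loc ⇒ (L4)** (the Sing-supported original, p583849): the same centre lies in `Sing S′`. [folklore] -/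
theorem localFullificationDimFour_of_localRes
    (hT : ∀ (k : Type) [Field k], LocalBlowupsAdmitDesingularization (Spec (.of k))) :
    LocalFullificationDimFour.LocalFullificationDimFour := by
  intro p hp k _ _ X f hsep hft hqc hint x _ S' g I hI hg hreg
  haveI := hft; haveI := hqc
  have hdes : Scheme.AdmitsDesingularization S' :=
    hT k X f x inferInstance S' g I hg fun s hs => by
      by_contra hne
      exact hs (hreg s hne)
  obtain ⟨𝓚, h1, h2, -, h4⟩ := exists_fullCentre_of_admitsDesingularization p hp f x S' g I hI hg hreg hdes
  exact ⟨𝓚, h1, h2, h4⟩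

/-! ## §3 The FULL blow-up model of every variety of dimension ≥ 4, modulo S_loc and the threefold package only -/

/-- **S_loc ∧ CP package ⇒ a `Sing X`-supported blow-up model FULL at every point, for every integral variety of dimension `≥ 4`** (through the
weakest-pair engine). [OURS · conditional-result] [cite: Temkin2008, Prop. 2.3.4] [cite: CossartPiltant2019, Thm. 1.1 (i)(ii); Prop. 4.4] -/
theorem exists_isBlowup_full_of_localRes
    (hT : ∀ (k : Type) [Field k], LocalBlowupsAdmitDesingularization (Spec (.of k)))
    (hG : CossartPiltant2019General.{0}) (h081R : Stacks081R.{0}) (hP : CossartPiltant2019Principalization.{0})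
    (p : ℕ) (hp : p.Prime) (k : Type) [Field k] [CharP k p] (X : Scheme.{0}) (f₀ : X ⟶ Spec (.of k))
    [IsSeparated f₀] [LocallyOfFiniteType f₀] [QuasiCompact f₀] [IsIntegral X] (hd : (4 : WithBot ℕ∞) ≤ topologicalKrullDim X) :
    ∃ (X'' : Scheme.{0}) (f'' : X'' ⟶ X) (J'' : X.IdealSheafData), IsBlowup f'' J'' ∧ J'' ≠ ⊥ ∧
      (J''.support : Set X) ⊆ (Scheme.regularLocus X)ᶜ ∧ ∀ x'' : X'', FullCl p (X''.presheaf.stalk x'') :=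
  FullBlowupOfLocalDoor.exists_isBlowup_full_of_LFclosed_of_LRfibre (localFullificationFibreClosedGe4_of_localRes hT) hG h081R hP
    (localResolutionNonClosedGe4Fibre_of_localRes hT) p hp k X f₀ hd

end Summit.ResolutionOfSingularities.ResolutionOfSingularities.Theorems.FInjectiveMacaulayfication.LocalDoorYardstick

end
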